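import Literature.NumberTheory.Automorphic.QuaternionicFormsClassNumber
import Literature.NumberTheory.Automorphic.QuaternionCoordOrderAdelicLiftProofs
import Literature.NumberTheory.Automorphic.QuaternionAlgebraSplitting
import HarnessLib

/-!
# `ℍ[𝔸_K^∞,a,b]^× = ⋃ᵢ ι(ℍ^×) dᵢ Ô^×`: finiteness of the class number, in coordinates

Topic `NumberTheory/Automorphic`; theorems and auxiliary definitions only (no named fact).
Eighth companion file of `QuaternionCoordOrder` on the way from its named fact
`QuaternionAlgebra.coordOrder_heckeDoubleCoset` to Kneser's strong approximation theorem
(Vignéras, LNM 800, Ch. III §4 Thm. 4.3). The compactness input of Vignéras's proof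
(*"`H_A^× = H_K^× H_S^× D` où `D` est compact dans `H_A` d'après (3.4)"*, i.e. the fundamental
finiteness theorem III §1 Thm. 1.4 / §5 Thm. 5.4: the class number of an order is finite) is
transported from the tree's `QuaternionicForm.finite_doubleQuotient_holds` (Borel 1963 Thm. 5.1
for `G = Dˣ`, proved in `QuaternionicFormsClassNumber` via Jordan–Zassenhaus), which lives on the
abstract finite-adelic unit group `(𝔸_K^∞ ⊗_K ℍ)ˣ` with its module topology, to the coordinate
model `ℍ[𝔸_K^∞,a,b]` of `QuaternionCoordOrderAdelicLiftProofs`: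

* `baseChangeEquiv K F a b : F ⊗[K] ℍ[K,a,b] ≃ₐ[F] ℍ[F,a,b]` with its formula on pure tensors
  (`baseChangeEquiv_tmul`; the construction of `QuaternionAlgebra.nonempty_baseChange_algEquiv`
  made explicit), and `adelicEquiv a b : (𝔸_K^∞ ⊗_K ℍ) ≃ₐ ℍ[𝔸_K^∞,a,b]` with
  `adelicEquiv (1 ⊗ q) = ι(q)` (`adelicEquiv_incl`);
* `adelicOrder a b = Ô = ∏_w O_w`, the subring of `ℍ[𝔸_K^∞,a,b]` of elements with coordinates in
  `𝒪̂_K`, and the open subgroup `integralUnits a b = Ô^×` of `(𝔸_K^∞ ⊗_K ℍ)ˣ` it defines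
  (`isOpen_integralUnits`, from the automatic continuity of `𝔸_K^∞`-linear maps out of the module
  topology);
* `exists_finset_units_eq` : **there is a finite set `T ⊆ ℍ[𝔸_K^∞,a,b]^×` such that every unit
  `h` of `ℍ[𝔸_K^∞,a,b]` is `ι(γ) t u` with `γ ∈ ℍ[K,a,b]^×`, `t ∈ T` and `u, u⁻¹ ∈ Ô`**
  (Vignéras III §5 Thm. 5.4 / Borel Thm. 5.1, in coordinates).

## References

* M.-F. Vignéras, *Arithmétique des algèbres de quaternions*, LNM 800 (1980), Ch. III §1
  Thm. 1.4, §4 (proof of Thm. 4.3), §5 Thm. 5.4 [VignerasLNM800].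
* A. Borel, *Some finiteness properties of adele groups over number fields*, Publ. Math. IHÉS 16
  (1963), Thm. 5.1 [BorelIHES1963].
-/

noncomputable section

open scoped Quaternion TensorProduct Pointwise
open NumberField IsDedekindDomain MulAction

namespace Literature.NumberTheory.Automorphic

/-! ### Base change of `ℍ[K,a,b]`, with its formula -/

section BaseChange

variable (K F : Type*) [Field K] [CommRing F] [Algebra K F] (a b : K) {α β : F}
  (hα : α = algebraMap K F a) (hβ : β = algebraMap K F b)

/-- The standard quaternionic basis `i, j, k` of `ℍ[F,α,β]` over `K`, where `α, β` are the images
of `a, b` (stated with explicit `α, β` and equations, so that the parameters of the target algebra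
can be written in any syntactic form). [folklore] -/
def QuaternionAlgebra.coeffBasis :
    _root_.QuaternionAlgebra.Basis (R := K) ℍ[F, α, β] a 0 b where
  i := ⟨0, 1, 0, 0⟩
  j := ⟨0, 0, 1, 0⟩
  k := ⟨0, 0, 0, 1⟩
  i_mul_i := by
    have hmap : ∀ s : K, algebraMap K ℍ[F, α, β] s = ⟨algebraMap K F s, 0, 0, 0⟩ := fun _ ↦ rfl
    ext <;> simp [Algebra.smul_def, hmap, hα]
  j_mul_j := by
    have hmap : ∀ s : K, algebraMap K ℍ[F, α, β] s = ⟨algebraMap K F s, 0, 0, 0⟩ := fun _ ↦ rfl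
    ext <;> simp [Algebra.smul_def, hmap, hβ]
  i_mul_j := by ext <;> simp
  j_mul_i := by ext <;> simp

/-- The coefficient extension `ℍ[K,a,b] →ₐ[K] ℍ[F,α,β]` is coordinatewise `algebraMap K F`.
[folklore] -/
theorem QuaternionAlgebra.coeffBasis_liftHom_apply (q : ℍ[K,a,b]) :
    (QuaternionAlgebra.coeffBasis K F a b hα hβ).liftHom q =
      ⟨algebraMap K F q.re, algebraMap K F q.imI, algebraMap K F q.imJ, algebraMap K F q.imK⟩ := by
  have hmap : ∀ s : K, algebraMap K ℍ[F, α, β] s = ⟨algebraMap K F s, 0, 0, 0⟩ := fun _ ↦ rfl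
  simp only [QuaternionAlgebra.Basis.liftHom_apply, QuaternionAlgebra.Basis.lift,
    QuaternionAlgebra.coeffBasis]
  ext <;> simp [hmap, Algebra.smul_def]

/-- The quaternionic basis `1 ⊗ i, 1 ⊗ j, 1 ⊗ k` of `F ⊗[K] ℍ[K,a,b]` over `F`, of type `(α, β)`.
[folklore] -/
def QuaternionAlgebra.tensorBasis :
    _root_.QuaternionAlgebra.Basis (R := F) (F ⊗[K] ℍ[K,a,b]) α 0 β where
  i := 1 ⊗ₜ ⟨0, 1, 0, 0⟩
  j := 1 ⊗ₜ ⟨0, 0, 1, 0⟩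
  k := 1 ⊗ₜ ⟨0, 0, 0, 1⟩
  i_mul_i := by
    rw [Algebra.TensorProduct.tmul_mul_tmul, one_mul, zero_smul, add_zero, hα, algebraMap_smul,
      Algebra.TensorProduct.one_def, ← TensorProduct.tmul_smul]
    congr 1
    ext <;> simp [Algebra.smul_def]
  j_mul_j := by
    rw [Algebra.TensorProduct.tmul_mul_tmul, one_mul, hβ, algebraMap_smul,
      Algebra.TensorProduct.one_def, ← TensorProduct.tmul_smul]
    congr 1
    ext <;> simp [Algebra.smul_def]
  i_mul_j := by
    rw [Algebra.TensorProduct.tmul_mul_tmul, one_mul]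
    congr 1
    ext <;> simp
  j_mul_i := by
    rw [Algebra.TensorProduct.tmul_mul_tmul, one_mul, zero_smul, zero_sub,
      ← TensorProduct.tmul_neg]
    congr 1
    ext <;> simp

/-- The algebra map `F ⊗[K] ℍ[K,a,b] →ₐ[F] ℍ[F,α,β]`, `f ⊗ q ↦ f · q`. [folklore] -/
def QuaternionAlgebra.baseChangeHom : F ⊗[K] ℍ[K,a,b] →ₐ[F] ℍ[F, α, β] :=
  Algebra.TensorProduct.lift (Algebra.ofId F _) (QuaternionAlgebra.coeffBasis K F a b hα hβ).liftHom
    (fun x _ ↦ _root_.QuaternionAlgebra.coe_commute x _)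

/-- `baseChangeHom (f ⊗ q) = f • (q with coefficients in F)`. [folklore] -/
theorem QuaternionAlgebra.baseChangeHom_tmul (f : F) (q : ℍ[K,a,b]) :
    QuaternionAlgebra.baseChangeHom K F a b hα hβ (f ⊗ₜ q) =
      f • (⟨algebraMap K F q.re, algebraMap K F q.imI, algebraMap K F q.imJ, algebraMap K F q.imK⟩ :
        ℍ[F, α, β]) := by
  rw [QuaternionAlgebra.baseChangeHom, Algebra.TensorProduct.lift_tmul,
    QuaternionAlgebra.coeffBasis_liftHom_apply, Algebra.ofId_apply, Algebra.smul_def]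

/-- **Base change of quaternion algebras, explicit**: `F ⊗[K] ℍ[K,a,b] ≃ₐ[F] ℍ[F,α,β]` for
`α, β` the images of `a, b`, `f ⊗ q ↦ f · q` (the algebra `H_F` of Vignéras I §2; the equivalence
of `QuaternionAlgebra.nonempty_baseChange_algEquiv`, as a definition). [cite: VignerasLNM800, Ch. I §2 (l'algèbre H_F)] -/
def QuaternionAlgebra.baseChangeEquiv : F ⊗[K] ℍ[K,a,b] ≃ₐ[F] ℍ[F, α, β] :=
  AlgEquiv.ofAlgHom (QuaternionAlgebra.baseChangeHom K F a b hα hβ)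
    (QuaternionAlgebra.tensorBasis K F a b hα hβ).liftHom
    (by
      apply _root_.QuaternionAlgebra.lift.symm.injective
      ext1 <;> simp [QuaternionAlgebra.baseChangeHom, QuaternionAlgebra.tensorBasis,
        QuaternionAlgebra.coeffBasis, QuaternionAlgebra.Basis.lift, Algebra.ofId_apply])
    (by
      ext
      · simp [QuaternionAlgebra.baseChangeHom, QuaternionAlgebra.tensorBasis,
          QuaternionAlgebra.coeffBasis, QuaternionAlgebra.Basis.lift, Algebra.ofId_apply]
      · simp [QuaternionAlgebra.baseChangeHom, QuaternionAlgebra.tensorBasis,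
          QuaternionAlgebra.coeffBasis, QuaternionAlgebra.Basis.lift, Algebra.ofId_apply])

/-- The base change equivalence on pure tensors: `f ⊗ q ↦ f · q`. [folklore] -/
theorem QuaternionAlgebra.baseChangeEquiv_tmul (f : F) (q : ℍ[K,a,b]) :
    QuaternionAlgebra.baseChangeEquiv K F a b hα hβ (f ⊗ₜ q) =
      f • (⟨algebraMap K F q.re, algebraMap K F q.imI, algebraMap K F q.imJ, algebraMap K F q.imK⟩ :
        ℍ[F, α, β]) :=
  QuaternionAlgebra.baseChangeHom_tmul K F a b hα hβ f q

end BaseChange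

namespace QuaternionAlgebra

/-- `ℍ⟮K; R; a, b⟯ := ℍ[K, algebraMap R K a, algebraMap R K b]` (file-local notation, as in
`QuaternionCoordOrder`). -/
local notation "ℍ⟮" K "; " R "; " a ", " b "⟯" =>
  QuaternionAlgebra K (algebraMap R K a) (0 : K) (algebraMap R K b)

variable {K : Type} [Field K] [NumberField K] (a b : 𝓞 K)

/-- `𝔸_K^∞`. -/
local notation "𝔸ᶠ" => FiniteAdeleRing (𝓞 K) K

/-! ### The coordinate model of `𝔸_K^∞ ⊗_K ℍ[K,a,b]` -/

/-- **`𝔸_K^∞ ⊗_K ℍ[K,a,b] ≃ₐ[𝔸_K^∞] ℍ[𝔸_K^∞,a,b]`**: the abstract finite-adelic algebra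
`ScalarExtension K 𝔸_K^∞ ℍ` of `QuaternionAlgebraAdelic` (carrying the module topology) is the
coordinate model `ℍ[𝔸_K^∞,a,b]` of `QuaternionCoordOrderAdelicLiftProofs` (Vignéras III §1,
Exemple 3: `H_A` in a basis of `H/K`). [cite: VignerasLNM800, Ch. III §1 (Exemples)] -/
def adelicEquiv : ScalarExtension K 𝔸ᶠ ℍ⟮K; 𝓞 K; a, b⟯ ≃ₐ[𝔸ᶠ] ℍ⟮𝔸ᶠ; 𝓞 K; a, b⟯ :=
  (ScalarExtension.ofTensor K 𝔸ᶠ ℍ⟮K; 𝓞 K; a, b⟯).symm.trans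
    (QuaternionAlgebra.baseChangeEquiv K 𝔸ᶠ (algebraMap (𝓞 K) K a) (algebraMap (𝓞 K) K b)
      (IsScalarTower.algebraMap_apply (𝓞 K) K 𝔸ᶠ a) (IsScalarTower.algebraMap_apply (𝓞 K) K 𝔸ᶠ b))

/-- **The diagonal maps agree**: `adelicEquiv (1 ⊗ q) = ι(q)` (`toFiniteAdele`). [folklore] -/
theorem adelicEquiv_incl (q : ℍ⟮K; 𝓞 K; a, b⟯) :
    adelicEquiv a b (ScalarExtension.incl K 𝔸ᶠ ℍ⟮K; 𝓞 K; a, b⟯ q) = toFiniteAdele a b q := by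
  rw [ScalarExtension.incl_apply, adelicEquiv, AlgEquiv.trans_apply, AlgEquiv.symm_apply_apply,
    QuaternionAlgebra.baseChangeEquiv_tmul, one_smul, toFiniteAdele_apply]

/-- The same on units: `adelicEquiv ∘ inclFinite = ι` on `ℍ^×`. [folklore] -/
theorem unitsMap_adelicEquiv_inclFinite (γ : (ℍ⟮K; 𝓞 K; a, b⟯)ˣ) :
    Units.map (adelicEquiv a b : ScalarExtension K 𝔸ᶠ ℍ⟮K; 𝓞 K; a, b⟯ ≃ₐ[𝔸ᶠ] ℍ⟮𝔸ᶠ; 𝓞 K; a, b⟯).toMonoidHom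
        (inclFinite K ℍ⟮K; 𝓞 K; a, b⟯ γ) =
      Units.map (toFiniteAdele a b).toMonoidHom γ :=
  Units.ext (adelicEquiv_incl a b (γ : ℍ⟮K; 𝓞 K; a, b⟯))

/-! ### `Ô = ∏_w O_w` and `Ô^×` -/

/-- **`Ô = ∏_w O_w`**: the subring of `ℍ[𝔸_K^∞,a,b]` of elements all of whose coordinates are
integral finite adeles (`integralFiniteAdeles K = 𝒪̂_K`); the adelic order attached to the
coordinate order `O` (Vignéras III §5 A: `X_A = ∏ X_v` for a lattice `X`). [cite: VignerasLNM800, Ch. III §5 A] -/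
def adelicOrder : Subring ℍ⟮𝔸ᶠ; 𝓞 K; a, b⟯ where
  carrier := {z | z.re ∈ integralFiniteAdeles K ∧ z.imI ∈ integralFiniteAdeles K ∧
    z.imJ ∈ integralFiniteAdeles K ∧ z.imK ∈ integralFiniteAdeles K}
  mul_mem' := by
    rintro x y ⟨hx₀, hx₁, hx₂, hx₃⟩ ⟨hy₀, hy₁, hy₂, hy₃⟩
    have ha : algebraMap (𝓞 K) 𝔸ᶠ a ∈ integralFiniteAdeles K :=
      algebraMap_integers_mem_integralFiniteAdeles K a
    have hb : algebraMap (𝓞 K) 𝔸ᶠ b ∈ integralFiniteAdeles K :=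
      algebraMap_integers_mem_integralFiniteAdeles K b
    simp only [Set.mem_setOf_eq, _root_.QuaternionAlgebra.re_mul, _root_.QuaternionAlgebra.imI_mul,
      _root_.QuaternionAlgebra.imJ_mul, _root_.QuaternionAlgebra.imK_mul, zero_mul, add_zero]
    refine ⟨?_, ?_, ?_, ?_⟩ <;> apply_rules [add_mem, sub_mem, mul_mem]
  one_mem' := by
    simp only [Set.mem_setOf_eq, _root_.QuaternionAlgebra.re_one, _root_.QuaternionAlgebra.imI_one,
      _root_.QuaternionAlgebra.imJ_one, _root_.QuaternionAlgebra.imK_one]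
    exact ⟨one_mem _, zero_mem _, zero_mem _, zero_mem _⟩
  add_mem' := by
    rintro x y ⟨hx₀, hx₁, hx₂, hx₃⟩ ⟨hy₀, hy₁, hy₂, hy₃⟩
    simp only [Set.mem_setOf_eq, _root_.QuaternionAlgebra.re_add, _root_.QuaternionAlgebra.imI_add,
      _root_.QuaternionAlgebra.imJ_add, _root_.QuaternionAlgebra.imK_add]
    exact ⟨add_mem hx₀ hy₀, add_mem hx₁ hy₁, add_mem hx₂ hy₂, add_mem hx₃ hy₃⟩
  zero_mem' := by
    simp only [Set.mem_setOf_eq, _root_.QuaternionAlgebra.re_zero, _root_.QuaternionAlgebra.imI_zero,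
      _root_.QuaternionAlgebra.imJ_zero, _root_.QuaternionAlgebra.imK_zero]
    exact ⟨zero_mem _, zero_mem _, zero_mem _, zero_mem _⟩
  neg_mem' := by
    rintro x ⟨hx₀, hx₁, hx₂, hx₃⟩
    simp only [Set.mem_setOf_eq, _root_.QuaternionAlgebra.re_neg, _root_.QuaternionAlgebra.imI_neg,
      _root_.QuaternionAlgebra.imJ_neg, _root_.QuaternionAlgebra.imK_neg]
    exact ⟨neg_mem hx₀, neg_mem hx₁, neg_mem hx₂, neg_mem hx₃⟩

/-- Membership in `Ô`: all four coordinates are integral (definitional). [folklore] -/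
theorem mem_adelicOrder_iff {z : ℍ⟮𝔸ᶠ; 𝓞 K; a, b⟯} :
    z ∈ adelicOrder a b ↔ z.re ∈ integralFiniteAdeles K ∧ z.imI ∈ integralFiniteAdeles K ∧
      z.imJ ∈ integralFiniteAdeles K ∧ z.imK ∈ integralFiniteAdeles K :=
  Iff.rfl

/-- **`Ô^×` inside `(𝔸_K^∞ ⊗_K ℍ)ˣ`**: the units `u` with `u, u⁻¹ ∈ Ô` (read through `adelicEquiv`);
Borel's `∏_𝔭 G_{𝔬_𝔭}` for `G = ℍ^×` at the coordinate order (Borel 1963 §1.2; Vignéras III §5).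
[cite: VignerasLNM800, Ch. III §5 A] -/
def integralUnits : Subgroup (finiteAdelicUnits K ℍ⟮K; 𝓞 K; a, b⟯) :=
  ((adelicOrder a b).toSubmonoid.comap
    ((adelicEquiv a b : ScalarExtension K 𝔸ᶠ ℍ⟮K; 𝓞 K; a, b⟯ ≃ₐ[𝔸ᶠ] ℍ⟮𝔸ᶠ; 𝓞 K; a, b⟯) :
      ScalarExtension K 𝔸ᶠ ℍ⟮K; 𝓞 K; a, b⟯ →* ℍ⟮𝔸ᶠ; 𝓞 K; a, b⟯)).units

/-- Membership in `Ô^×`: `Φ u ∈ Ô` and `Φ u⁻¹ ∈ Ô`. [folklore] -/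
theorem mem_integralUnits_iff {u : finiteAdelicUnits K ℍ⟮K; 𝓞 K; a, b⟯} :
    u ∈ integralUnits a b ↔
      adelicEquiv a b (u : ScalarExtension K 𝔸ᶠ ℍ⟮K; 𝓞 K; a, b⟯) ∈ adelicOrder a b ∧
      adelicEquiv a b ((u⁻¹ : finiteAdelicUnits K ℍ⟮K; 𝓞 K; a, b⟯) :
        ScalarExtension K 𝔸ᶠ ℍ⟮K; 𝓞 K; a, b⟯) ∈ adelicOrder a b := by
  rw [integralUnits, Submonoid.mem_units_iff, Submonoid.mem_comap, Submonoid.mem_comap]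
  rfl

/-- The coordinates of `Φ z`, an `𝔸_K^∞`-linear map `𝔸_K^∞ ⊗_K ℍ → (𝔸_K^∞)⁴`. [folklore] -/
def adelicCoords : ScalarExtension K 𝔸ᶠ ℍ⟮K; 𝓞 K; a, b⟯ →ₗ[𝔸ᶠ] (Fin 4 → 𝔸ᶠ) :=
  (_root_.QuaternionAlgebra.linearEquivTuple (algebraMap (𝓞 K) 𝔸ᶠ a) (0 : 𝔸ᶠ)
      (algebraMap (𝓞 K) 𝔸ᶠ b)).toLinearMap ∘ₗ
    (adelicEquiv a b : ScalarExtension K 𝔸ᶠ ℍ⟮K; 𝓞 K; a, b⟯ ≃ₐ[𝔸ᶠ] ℍ⟮𝔸ᶠ; 𝓞 K; a, b⟯).toLinearEquiv.toLinearMap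

/-- The coordinates of `Φ z`, explicitly. [folklore] -/
theorem adelicCoords_apply (z : ScalarExtension K 𝔸ᶠ ℍ⟮K; 𝓞 K; a, b⟯) :
    adelicCoords a b z = ![(adelicEquiv a b z).re, (adelicEquiv a b z).imI,
      (adelicEquiv a b z).imJ, (adelicEquiv a b z).imK] := by
  simp only [adelicCoords, LinearMap.coe_comp, LinearEquiv.coe_coe, Function.comp_apply,
    _root_.QuaternionAlgebra.coe_linearEquivTuple, _root_.QuaternionAlgebra.equivTuple_apply]
  rfl

/-- The coordinate map is continuous for the module topology (automatic continuity of linear maps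
out of a module topology, Mathlib `IsModuleTopology.continuous_of_linearMap`). [folklore] -/
theorem continuous_adelicCoords : Continuous (adelicCoords a b) :=
  IsModuleTopology.continuous_of_linearMap _

/-- `Φ⁻¹(Ô)` is open in `𝔸_K^∞ ⊗_K ℍ` (the preimage of the open box `𝒪̂_K⁴` under the continuous
coordinate map). [folklore] -/
theorem isOpen_preimage_adelicOrder :
    IsOpen ((adelicEquiv a b : ScalarExtension K 𝔸ᶠ ℍ⟮K; 𝓞 K; a, b⟯ ≃ₐ[𝔸ᶠ] ℍ⟮𝔸ᶠ; 𝓞 K; a, b⟯) ⁻¹'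
      (adelicOrder a b : Set ℍ⟮𝔸ᶠ; 𝓞 K; a, b⟯)) := by
  have h : ((adelicEquiv a b : ScalarExtension K 𝔸ᶠ ℍ⟮K; 𝓞 K; a, b⟯ ≃ₐ[𝔸ᶠ] ℍ⟮𝔸ᶠ; 𝓞 K; a, b⟯) ⁻¹'
      (adelicOrder a b : Set ℍ⟮𝔸ᶠ; 𝓞 K; a, b⟯)) =
      adelicCoords a b ⁻¹' Set.pi Set.univ (fun _ => (integralFiniteAdeles K : Set 𝔸ᶠ)) := by
    ext z
    simp only [Set.mem_preimage, SetLike.mem_coe, mem_adelicOrder_iff, adelicCoords_apply,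
      Set.mem_pi, Set.mem_univ, true_implies, Fin.forall_fin_succ, IsEmpty.forall_iff,
      Matrix.cons_val_zero, Matrix.cons_val_succ, and_true]
  rw [h]
  exact (isOpen_set_pi Set.finite_univ fun _ _ => isOpen_integralFiniteAdeles K).preimage
    (continuous_adelicCoords a b)

/-- **`Ô^×` is open** in `(𝔸_K^∞ ⊗_K ℍ)ˣ`. [folklore] -/
theorem isOpen_integralUnits :
    IsOpen (integralUnits a b : Set (finiteAdelicUnits K ℍ⟮K; 𝓞 K; a, b⟯)) := by
  have h : (integralUnits a b : Set (finiteAdelicUnits K ℍ⟮K; 𝓞 K; a, b⟯)) =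
      Units.val ⁻¹' ((adelicEquiv a b : ScalarExtension K 𝔸ᶠ ℍ⟮K; 𝓞 K; a, b⟯ ≃ₐ[𝔸ᶠ]
          ℍ⟮𝔸ᶠ; 𝓞 K; a, b⟯) ⁻¹' (adelicOrder a b : Set ℍ⟮𝔸ᶠ; 𝓞 K; a, b⟯)) ∩
        (fun u : finiteAdelicUnits K ℍ⟮K; 𝓞 K; a, b⟯ =>
          ((u⁻¹ : finiteAdelicUnits K ℍ⟮K; 𝓞 K; a, b⟯) : ScalarExtension K 𝔸ᶠ ℍ⟮K; 𝓞 K; a, b⟯)) ⁻¹'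
          ((adelicEquiv a b : ScalarExtension K 𝔸ᶠ ℍ⟮K; 𝓞 K; a, b⟯ ≃ₐ[𝔸ᶠ]
            ℍ⟮𝔸ᶠ; 𝓞 K; a, b⟯) ⁻¹' (adelicOrder a b : Set ℍ⟮𝔸ᶠ; 𝓞 K; a, b⟯)) := by
    ext u
    exact mem_integralUnits_iff a b
  rw [h]
  exact ((isOpen_preimage_adelicOrder a b).preimage Units.continuous_val).inter
    ((isOpen_preimage_adelicOrder a b).preimage Units.continuous_coe_inv)

/-! ### Finiteness of the class number, in coordinates -/

/-- From a finite double quotient to representatives: if `Γ \ G / U` is finite (`Γ, U ≤ G`), there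
is a finite `T ⊆ G` with `G = Γ T U`. [folklore] -/
theorem exists_finset_eq_mul_mul_of_finite {G : Type*} [Group G] (Γ U : Subgroup G)
    (hfin : Finite (orbitRel.Quotient Γ (G ⧸ U))) :
    ∃ T : Finset G, ∀ x : G, ∃ γ ∈ Γ, ∃ t ∈ T, ∃ u ∈ U, x = γ * t * u := by
  classical
  haveI : Fintype (orbitRel.Quotient Γ (G ⧸ U)) := Fintype.ofFinite _
  let cls : G → orbitRel.Quotient Γ (G ⧸ U) := fun x => Quotient.mk'' (x : G ⧸ U)
  have hrep : ∀ q : orbitRel.Quotient Γ (G ⧸ U), ∃ t : G, cls t = q := by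
    intro q
    induction q using Quotient.inductionOn' with
    | h y =>
      induction y using QuotientGroup.induction_on with
      | H x => exact ⟨x, rfl⟩
  choose rep hrep using hrep
  refine ⟨Finset.univ.image rep, fun x => ?_⟩
  have hx : cls (rep (cls x)) = cls x := hrep (cls x)
  -- `rep ∈ orbit Γ x̄`: `g • x̄ = rep̄` for some `g ∈ Γ`
  obtain ⟨g, hg⟩ := MulAction.mem_orbit_iff.mp (Quotient.eq''.mp hx)
  have hg' : (((g : G) * x : G) : G ⧸ U) = (rep (cls x) : G ⧸ U) := by
    have h : (g : G) • (x : G ⧸ U) = (rep (cls x) : G ⧸ U) := hg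
    rwa [MulAction.Quotient.smul_coe, smul_eq_mul] at h
  have hu : ((g : G) * x)⁻¹ * rep (cls x) ∈ U := QuotientGroup.eq.mp hg'
  refine ⟨(g : G)⁻¹, Γ.inv_mem g.2, rep (cls x), Finset.mem_image_of_mem _ (Finset.mem_univ _),
    (((g : G) * x)⁻¹ * rep (cls x))⁻¹, U.inv_mem hu, ?_⟩
  group

/-- **Finiteness of the class number of the coordinate order, in coordinates** (Vignéras III §5
Thm. 5.4; Borel 1963 Thm. 5.1 for `G = ℍ^×`, `QuaternionicForm.finite_doubleQuotient_holds`):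
for `a b ≠ 0` there is a finite set `T` of units of `ℍ[𝔸_K^∞,a,b]` such that every unit `h` is
`ι(γ) · t · u` with `γ ∈ ℍ[K,a,b]^×`, `t ∈ T` and `u, u⁻¹ ∈ Ô = ∏_w O_w` — the decomposition
`H_A^× = H_K^× D`, `D = ⋃ t Ô^×` compact, used in Vignéras's proof of Thm. III.4.3.
[cite: VignerasLNM800, Ch. III §5 Thm. 5.4 and §4 (proof of Thm. 4.3)] [cite: BorelIHES1963, Thm. 5.1] -/
theorem exists_finset_units_eq (ha : a ≠ 0) (hb : b ≠ 0) :
    ∃ T : Finset (ℍ⟮𝔸ᶠ; 𝓞 K; a, b⟯)ˣ, ∀ h : (ℍ⟮𝔸ᶠ; 𝓞 K; a, b⟯)ˣ,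
      ∃ γ : (ℍ⟮K; 𝓞 K; a, b⟯)ˣ, ∃ t ∈ T, ∃ u : (ℍ⟮𝔸ᶠ; 𝓞 K; a, b⟯)ˣ,
        (u : ℍ⟮𝔸ᶠ; 𝓞 K; a, b⟯) ∈ adelicOrder a b ∧
        ((u⁻¹ : (ℍ⟮𝔸ᶠ; 𝓞 K; a, b⟯)ˣ) : ℍ⟮𝔸ᶠ; 𝓞 K; a, b⟯) ∈ adelicOrder a b ∧
        h = Units.map (toFiniteAdele a b).toMonoidHom γ * t * u := by
  classical
  have hinj := FaithfulSMul.algebraMap_injective (𝓞 K) K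
  haveI : IsQuaternionAlgebra K ℍ⟮K; 𝓞 K; a, b⟯ :=
    QuaternionAlgebra.isQuaternionAlgebra_holds ((map_ne_zero_iff _ hinj).mpr ha)
      ((map_ne_zero_iff _ hinj).mpr hb)
  have hfin := QuaternionicForm.finite_doubleQuotient_holds (integralUnits a b) (isOpen_integralUnits a b)
  obtain ⟨T, hT⟩ := exists_finset_eq_mul_mul_of_finite _ _ hfin
  refine ⟨T.image (Units.map (adelicEquiv a b : ScalarExtension K 𝔸ᶠ ℍ⟮K; 𝓞 K; a, b⟯ ≃ₐ[𝔸ᶠ]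
    ℍ⟮𝔸ᶠ; 𝓞 K; a, b⟯).toMonoidHom), fun h => ?_⟩
  obtain ⟨γ', hγ', t, ht, u, hu, hx⟩ := hT (Units.map (adelicEquiv a b : ScalarExtension K 𝔸ᶠ
    ℍ⟮K; 𝓞 K; a, b⟯ ≃ₐ[𝔸ᶠ] ℍ⟮𝔸ᶠ; 𝓞 K; a, b⟯).symm.toMonoidHom h)
  obtain ⟨γ, rfl⟩ := hγ'
  have hback : Units.map (adelicEquiv a b : ScalarExtension K 𝔸ᶠ ℍ⟮K; 𝓞 K; a, b⟯ ≃ₐ[𝔸ᶠ]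
      ℍ⟮𝔸ᶠ; 𝓞 K; a, b⟯).toMonoidHom (Units.map (adelicEquiv a b : ScalarExtension K 𝔸ᶠ
        ℍ⟮K; 𝓞 K; a, b⟯ ≃ₐ[𝔸ᶠ] ℍ⟮𝔸ᶠ; 𝓞 K; a, b⟯).symm.toMonoidHom h) = h :=
    Units.ext ((adelicEquiv a b).apply_symm_apply (h : ℍ⟮𝔸ᶠ; 𝓞 K; a, b⟯))
  refine ⟨γ, Units.map (adelicEquiv a b : ScalarExtension K 𝔸ᶠ ℍ⟮K; 𝓞 K; a, b⟯ ≃ₐ[𝔸ᶠ]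
      ℍ⟮𝔸ᶠ; 𝓞 K; a, b⟯).toMonoidHom t, Finset.mem_image_of_mem _ ht,
    Units.map (adelicEquiv a b : ScalarExtension K 𝔸ᶠ ℍ⟮K; 𝓞 K; a, b⟯ ≃ₐ[𝔸ᶠ]
      ℍ⟮𝔸ᶠ; 𝓞 K; a, b⟯).toMonoidHom u, ?_, ?_, ?_⟩
  · exact ((mem_integralUnits_iff a b).mp hu).1
  · rw [← map_inv]
    exact ((mem_integralUnits_iff a b).mp hu).2
  · rw [← hback, hx, map_mul, map_mul, ← unitsMap_adelicEquiv_inclFinite]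

end QuaternionAlgebra

end Literature.NumberTheory.Automorphic
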